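import Mathlib.MeasureTheory.Group.FundamentalDomain
import Mathlib.MeasureTheory.Measure.Haar.Basic
import Mathlib.MeasureTheory.Measure.Prod
import Mathlib.Topology.Algebra.Group.Basic
import HarnessLib

/-!
# Descent of finite covolume to a closed subgroup: the orbit-count unfolding inequality

Topic `MeasureTheory/Group`; namespace `Literature.MeasureTheory.Group`. Abstract measure theory
(Mathlib only): theorems, no definition, no named fact, no `sorry`.

This is the measure-theoretic spine of Borel–Harish-Chandra's finiteness theorem in the form
«a lattice `Γ` of `R` cuts out a lattice `Γ ∩ U` of a closed subgroup `U` as soon as the `Γ`-orbit of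
the point of `R/U` fixed by `U` is *sparse* along a fundamental set of `Γ`» (A. Borel,
Harish-Chandra, *Arithmetic subgroups of algebraic groups*, Ann. of Math. 75 (1962), §7; A. Borel,
*Some finiteness properties of adele groups over number fields*, Publ. Math. IHÉS 16 (1963), §5;
R. Godement, *Domaines fondamentaux des groupes arithmétiques*, Sém. Bourbaki 257, §4 — the
«descent» from `GL_N` to a stabiliser). Setting: `R` a locally compact second countable Hausdorff
group with a left Haar measure `μ`; `U ≤ R` a closed subgroup with a left-invariant measure `ν`;
`Γ ≤ R` a subgroup, `Λ ≤ U` the subgroup with `↑Λ = Γ ∩ U`; `F_R ⊆ R` and `F_U ⊆ U` fundamental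
domains for the LEFT multiplication actions of `Γ` and `Λ`; `P ⊆ R` a compact set; and a
«class map» `τ : Γ → X` whose fibres are the cosets `Λ γ` (`τ γ = τ γ' ↔ γ' γ⁻¹ ∈ U`; in the
application `τ γ = γ^* H γ`, the hermitian form moved by `γ`).

* `measure_slice_le` — **the uniform slice bound**: for every `x ∈ R`,
  `ν {u ∈ U : u⁻¹ x ∈ P} ≤ ν {u ∈ U : u ∈ P P⁻¹}` (two points of a slice differ by an element of
  `U ∩ P P⁻¹`; left-invariance of `ν`), finite for compact `P`;
* `lintegral_measure_inter_slice` — **Tonelli**: `∫_R ν(F ∩ {u : u⁻¹ x ∈ P}) dμ(x) = ν(F) μ(P)`;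
* `tsum_measure_inter_slice_le` — **regrouping a `Γ`-orbit by `Λ`-cosets**:
  `Σ_{γ ∈ Γ} ν(F_U ∩ {u : u⁻¹ γ x ∈ P}) ≤ ν(U ∩ PP⁻¹) · #τ{γ : γ x ∈ U P}` (the `Λ`-sum over a
  coset reassembles `ν` of one slice by the fundamental-domain identity);
* `covolume_mul_measure_le_lintegral_encard` — **the unfolding inequality**
  `ν(F_U) μ(P) ≤ ν(U ∩ PP⁻¹) · ∫_{F_R} #τ{γ : γ g ∈ U P} dμ(g)`: finiteness of the orbit-count
  integral over a fundamental domain of `Γ` gives FINITE COVOLUME of `Λ` in `U`;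
* `setLIntegral_inter_le_of_subset_iUnion_smul` — **domination**: for a left-`Γ`-invariant
  `f ≥ 0` and `A ⊆ Γ · S`, `∫_{F_R ∩ A} f ≤ ∫_S f` (how a Siegel set `S` with `Γ S ⊇ A` controls
  the integral over `Γ\A`).
That finite covolume forces unimodularity (`Δ_U ≡ 1`) is the tree's
`Literature.NumberTheory.Automorphic.modularCharacterFun_eq_one_of_isFundamentalDomain`
(`LatticeUnimodular`), not repeated here.

## References

* A. Borel, Harish-Chandra, *Arithmetic subgroups of algebraic groups*, Ann. of Math. 75 (1962),
  §§6–7 (Thm. 7.8), §9. [BorelHarishChandra1962]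
* R. Godement, *Domaines fondamentaux des groupes arithmétiques*, Sém. Bourbaki 257 (1962/63),
  §4, §8. [Godement1964]
* A. Borel, *Some finiteness properties of adele groups over number fields*, Publ. Math. IHÉS 16
  (1963), §5. [Borel1963]
* M. S. Raghunathan, *Discrete subgroups of Lie groups* (1972), Ch. I, 1.4–1.9. [Raghunathan1972]
-/

noncomputable section

open MeasureTheory Measure Set
open scoped ENNReal Pointwise

namespace Literature.MeasureTheory.Group

section Slice

variable {R : Type*} [Group R] [TopologicalSpace R] [IsTopologicalGroup R]
  (U : Subgroup R) [MeasurableSpace U] [BorelSpace U]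

/-- **Uniform slice bound.** For a left-invariant measure `ν` on a subgroup `U ≤ R`, a set
`P ⊆ R` and ANY `x ∈ R`: `ν {u ∈ U : u⁻¹ x ∈ P} ≤ ν {u ∈ U : u ∈ P · P⁻¹}` — if `u₀, u` lie in the
slice then `u₀⁻¹ u = (u₀⁻¹ x)(u⁻¹ x)⁻¹ ∈ P P⁻¹`, so the slice is contained in the left translate
`u₀ · (U ∩ P P⁻¹)` (the uniform bound behind Borel–Harish-Chandra's descent of finiteness of volume
to a stabiliser). [cite: BorelHarishChandra1962, §7] [cite: Raghunathan1972, Ch. I 1.4--1.9] -/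
theorem measure_slice_le (ν : Measure U) [ν.IsMulLeftInvariant] (P : Set R) (x : R) :
    ν {u : U | ((u : R))⁻¹ * x ∈ P} ≤ ν {u : U | (u : R) ∈ P * P⁻¹} := by
  rcases Set.eq_empty_or_nonempty {u : U | ((u : R))⁻¹ * x ∈ P} with h | ⟨u₀, hu₀⟩
  · rw [h, measure_empty]
    exact bot_le
  · have hsub : {u : U | ((u : R))⁻¹ * x ∈ P} ⊆
        (fun u : U => u₀⁻¹ * u) ⁻¹' {u : U | (u : R) ∈ P * P⁻¹} := by
      intro u hu
      simp only [Set.mem_setOf_eq] at hu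
      simp only [Set.mem_preimage, Set.mem_setOf_eq, Subgroup.coe_mul, Subgroup.coe_inv]
      refine Set.mem_mul.2 ⟨((u₀ : R))⁻¹ * x, hu₀, (((u : R))⁻¹ * x)⁻¹, Set.inv_mem_inv.2 hu, ?_⟩
      group
    calc ν {u : U | ((u : R))⁻¹ * x ∈ P}
        ≤ ν ((fun u : U => u₀⁻¹ * u) ⁻¹' {u : U | (u : R) ∈ P * P⁻¹}) := measure_mono hsub
      _ = ν {u : U | (u : R) ∈ P * P⁻¹} := measure_preimage_mul ν u₀⁻¹ _

omit [MeasurableSpace U] [BorelSpace U] in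
/-- The slice bound is FINITE for compact `P` and closed `U`: `U ∩ P P⁻¹` is compact in `U`
(private plumbing). [folklore] -/
private theorem isCompact_coe_mem_mul_inv (hU : IsClosed (U : Set R)) {P : Set R} (hP : IsCompact P) :
    IsCompact {u : U | (u : R) ∈ P * P⁻¹} :=
  hU.isClosedEmbedding_subtypeVal.isCompact_preimage (hP.mul hP.inv)

omit [BorelSpace U] in
/-- Hence `ν(U ∩ P P⁻¹) < ∞` for a measure finite on compacts (private plumbing). [folklore] -/
private theorem measure_coe_mem_mul_inv_lt_top (hU : IsClosed (U : Set R)) (ν : Measure U)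
    [IsFiniteMeasureOnCompacts ν] {P : Set R} (hP : IsCompact P) :
    ν {u : U | (u : R) ∈ P * P⁻¹} < ∞ :=
  (isCompact_coe_mem_mul_inv U hU hP).measure_lt_top

variable [MeasurableSpace R] [BorelSpace R] [SecondCountableTopology R]

omit [BorelSpace U] in
/-- The set `{(x, u) : u ∈ F, u⁻¹ x ∈ P} ⊆ R × U` is measurable for measurable `F`, `P`
(private plumbing). [folklore] -/
private theorem measurableSet_slicePairs [OpensMeasurableSpace U] {F : Set U} (hF : MeasurableSet F)
    {P : Set R} (hP : MeasurableSet P) :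
    MeasurableSet {p : R × U | p.2 ∈ F ∧ ((p.2 : R))⁻¹ * p.1 ∈ P} := by
  have hmeas : Measurable fun p : R × U => ((p.2 : R))⁻¹ * p.1 :=
    ((continuous_subtype_val.comp continuous_snd).inv.mul continuous_fst).measurable
  exact (measurable_snd hF).inter (hmeas hP)

/-- **The slice measure is a measurable function of the base point**: `x ↦ ν(F ∩ {u : u⁻¹x ∈ P})`
is measurable (sections of a measurable set, Mathlib `measurable_measure_prodMk_left`; private
plumbing). [folklore] -/
private theorem measurable_measure_inter_slice (ν : Measure U) [SFinite ν] {F : Set U}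
    (hF : MeasurableSet F) {P : Set R} (hP : MeasurableSet P) :
    Measurable fun x : R => ν (F ∩ {u : U | ((u : R))⁻¹ * x ∈ P}) :=
  measurable_measure_prodMk_left (measurableSet_slicePairs U hF hP)

/-- **Tonelli for slices.** For a left-invariant `μ` on `R`, any s-finite `ν` on `U`, measurable
`F ⊆ U` and `P ⊆ R`: `∫_R ν(F ∩ {u : u⁻¹ x ∈ P}) dμ(x) = ν(F) · μ(P)` — both sides are the
`μ ⊗ ν`-measure of `{(x, u) : u ∈ F, x ∈ u P}`, and `μ(u P) = μ(P)`.
[cite: Raghunathan1972, Ch. I 1.4--1.9] [cite: BorelHarishChandra1962, §7] -/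
theorem lintegral_measure_inter_slice (μ : Measure R) [μ.IsMulLeftInvariant] [SFinite μ]
    (ν : Measure U) [SFinite ν] {F : Set U} (hF : MeasurableSet F) {P : Set R}
    (hP : MeasurableSet P) :
    ∫⁻ x, ν (F ∩ {u : U | ((u : R))⁻¹ * x ∈ P}) ∂μ = ν F * μ P := by
  set E : Set (R × U) := {p | p.2 ∈ F ∧ ((p.2 : R))⁻¹ * p.1 ∈ P} with hE
  have hEm : MeasurableSet E := measurableSet_slicePairs U hF hP
  have h1 : ∀ x, ν (F ∩ {u : U | ((u : R))⁻¹ * x ∈ P}) = ν (Prod.mk x ⁻¹' E) := fun x => rfl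
  simp_rw [h1]
  rw [← Measure.prod_apply hEm, Measure.prod_apply_symm hEm]
  have h2 : ∀ u : U, μ ((fun x => (x, u)) ⁻¹' E) = F.indicator (fun _ => μ P) u := by
    intro u
    by_cases hu : u ∈ F
    · rw [Set.indicator_of_mem hu]
      have : (fun x => (x, u)) ⁻¹' E = (fun x => ((u : R))⁻¹ * x) ⁻¹' P := by
        ext x
        simp [hE, hu]
      rw [this, measure_preimage_mul]
    · rw [Set.indicator_of_notMem hu]
      have : (fun x => (x, u)) ⁻¹' E = ∅ := by
        ext x
        simp [hE, hu]
      rw [this, measure_empty]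
  simp_rw [h2]
  rw [lintegral_indicator_const hF, mul_comm]

end Slice

section Unfolding

variable {R : Type*} [Group R] [TopologicalSpace R] [IsTopologicalGroup R]
  [MeasurableSpace R] [BorelSpace R] [SecondCountableTopology R]
  (U : Subgroup R) [MeasurableSpace U] [BorelSpace U]

omit [MeasurableSpace R] [BorelSpace R] [SecondCountableTopology R] in
/-- **Regrouping a `Γ`-orbit by `Λ`-cosets.** Let `ν` be left-invariant on `U`, `Λ ≤ U` the
subgroup `Γ ∩ U` (countable), `F_U` a fundamental domain for the left action of `Λ` on `U`, and
`τ : Γ → X` a map with `τ γ = τ γ' ↔ γ' γ⁻¹ ∈ U` (its fibres are the cosets `Λ γ`). Then for every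
`x ∈ R`:
`Σ_{γ ∈ Γ} ν(F_U ∩ {u : u⁻¹ γ x ∈ P}) ≤ ν(U ∩ P P⁻¹) · #(τ {γ ∈ Γ : γ x ∈ U · P})`.
Proof: `Γ ≃ Λ × (range τ)` through a section `s` of `τ` (`γ = δ · s(τ γ)`); for fixed class `y`
the slices `{u : u⁻¹ δ s_y x ∈ P} = δ · {u : u⁻¹ s_y x ∈ P}` are the `Λ`-translates of ONE slice
`T_y`, so `Σ_δ ν(F_U ∩ δ T_y) = ν(T_y)` (fundamental domain), which is `≤ ν(U ∩ PP⁻¹)`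
(`measure_slice_le`) and vanishes unless `s_y x ∈ U P`.
[cite: BorelHarishChandra1962, §7] [cite: Raghunathan1972, Ch. I 1.4--1.9] -/
theorem tsum_measure_inter_slice_le (ν : Measure U) [ν.IsMulLeftInvariant]
    (Γ : Subgroup R) (Λ : Subgroup U) [Countable Λ] (hΛ : ∀ u : U, u ∈ Λ ↔ (u : R) ∈ Γ)
    {F_U : Set U} (hFU : IsFundamentalDomain Λ F_U ν) (P : Set R)
    {X : Type*} (τ : Γ → X) (hτ : ∀ γ γ' : Γ, τ γ = τ γ' ↔ (γ' : R) * ((γ : R))⁻¹ ∈ U) (x : R) :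
    ∑' γ : Γ, ν (F_U ∩ {u : U | ((u : R))⁻¹ * ((γ : R) * x) ∈ P}) ≤
      ν {u : U | (u : R) ∈ P * P⁻¹} *
        ((τ '' {γ : Γ | (γ : R) * x ∈ (U : Set R) * P}).encard : ℝ≥0∞) := by
  classical
  -- a section of `τ` over its range
  set Y : Set X := Set.range τ with hY
  have hsec : ∀ y : Y, ∃ γ : Γ, τ γ = (y : X) := fun y => y.2
  choose s hs using hsec
  -- the class of `δ · s y` is `y`, for `δ ∈ U`
  have hclass : ∀ (γ : Γ) (y : Y), (γ : R) * ((s y : R))⁻¹ ∈ U → τ γ = (y : X) := by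
    intro γ y h
    rw [← hs y]
    exact ((hτ (s y) γ).2 h).symm
  -- the bijection `Λ × Y ≃ Γ`, `(δ, y) ↦ δ · s y`
  let e : Λ × Y → Γ := fun p =>
    ⟨((p.1 : U) : R) * (s p.2 : R), Γ.mul_mem ((hΛ p.1).1 p.1.2) (s p.2).2⟩
  have he_coe : ∀ p : Λ × Y, ((e p : Γ) : R) = ((p.1 : U) : R) * (s p.2 : R) := fun p => rfl
  have he_class : ∀ p : Λ × Y, τ (e p) = (p.2 : X) := by
    intro p
    refine hclass (e p) p.2 ?_
    rw [he_coe, mul_inv_cancel_right]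
    exact ((p.1 : U)).2
  have he_bij : Function.Bijective e := by
    constructor
    · rintro ⟨δ, y⟩ ⟨δ', y'⟩ h
      have hy : y = y' := by
        apply Subtype.ext
        rw [← he_class (δ, y), ← he_class (δ', y'), h]
      subst hy
      have hδ : ((δ : U) : R) = ((δ' : U) : R) := by
        have := congrArg (fun γ : Γ => (γ : R)) h
        simp only [he_coe] at this
        exact mul_right_cancel this
      have : δ = δ' := Subtype.ext (Subtype.ext hδ)
      rw [this]
    · intro γ
      let y : Y := ⟨τ γ, γ, rfl⟩
      have hmemU : (γ : R) * ((s y : R))⁻¹ ∈ U := (hτ (s y) γ).1 (by rw [hs y])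
      have hmemΓ : (γ : R) * ((s y : R))⁻¹ ∈ Γ := Γ.mul_mem γ.2 (Γ.inv_mem (s y).2)
      refine ⟨(⟨⟨(γ : R) * ((s y : R))⁻¹, hmemU⟩, (hΛ _).2 hmemΓ⟩, y), ?_⟩
      apply Subtype.ext
      rw [he_coe]
      exact inv_mul_cancel_right (γ : R) (s y : R)
  let eqv : Λ × Y ≃ Γ := Equiv.ofBijective e he_bij
  -- the slice of the class `y` and its `Λ`-translates
  set T : Y → Set U := fun y => {u : U | ((u : R))⁻¹ * ((s y : R) * x) ∈ P} with hT
  have hslice : ∀ (δ : Λ) (y : Y),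
      {u : U | ((u : R))⁻¹ * (((e (δ, y) : Γ) : R) * x) ∈ P} = δ • T y := by
    intro δ y
    ext u
    rw [Set.mem_smul_set_iff_inv_smul_mem]
    simp only [Set.mem_setOf_eq, hT, he_coe, Subgroup.smul_def, smul_eq_mul, Subgroup.coe_mul,
      Subgroup.coe_inv, mul_inv_rev, inv_inv, mul_assoc]
  -- regroup the sum: `Σ_γ = Σ_y Σ_δ`
  have hre : ∑' γ : Γ, ν (F_U ∩ {u : U | ((u : R))⁻¹ * ((γ : R) * x) ∈ P}) =
      ∑' y : Y, ∑' δ : Λ, ν (F_U ∩ δ • T y) := by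
    rw [← eqv.tsum_eq]
    simp only [eqv, Equiv.ofBijective_apply]
    rw [ENNReal.tsum_prod', ENNReal.tsum_comm]
    refine tsum_congr fun y => tsum_congr fun δ => ?_
    rw [hslice]
  -- the `Λ`-sum over a class reassembles `ν (T y)`
  have hfd : ∀ y : Y, ∑' δ : Λ, ν (F_U ∩ δ • T y) = ν (T y) := by
    intro y
    have h1 : ∀ δ : Λ, ν (F_U ∩ δ • T y) = ν (T y ∩ δ⁻¹ • F_U) := by
      intro δ
      have hset : F_U ∩ δ • T y = δ • (δ⁻¹ • F_U ∩ T y) := by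
        rw [Set.smul_set_inter, smul_inv_smul]
      rw [hset, measure_smul, Set.inter_comm]
    simp_rw [h1]
    rw [hFU.measure_eq_tsum' (T y)]
    exact (Equiv.inv Λ).tsum_eq (fun δ => ν (T y ∩ δ • F_U))
  rw [hre]
  simp_rw [hfd]
  -- each class contributes at most `ν(U ∩ PP⁻¹)`, and only if `s y · x ∈ U P`
  set S : Set X := τ '' {γ : Γ | (γ : R) * x ∈ (U : Set R) * P} with hS
  have hbound : ∀ y : Y, ν (T y) ≤ S.indicator (fun _ => ν {u : U | (u : R) ∈ P * P⁻¹}) y := by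
    intro y
    by_cases hy : (y : X) ∈ S
    · rw [Set.indicator_of_mem hy]
      exact measure_slice_le U ν P _
    · rw [Set.indicator_of_notMem hy]
      have hTe : T y = ∅ := by
        refine Set.eq_empty_of_forall_notMem fun u hu => hy ?_
        refine ⟨s y, ?_, hs y⟩
        refine Set.mem_mul.2 ⟨(u : R), u.2, ((u : R))⁻¹ * ((s y : R) * x), hu, ?_⟩
        rw [mul_inv_cancel_left]
      rw [hTe, measure_empty]
  calc ∑' y : Y, ν (T y)
      ≤ ∑' y : Y, S.indicator (fun _ => ν {u : U | (u : R) ∈ P * P⁻¹}) (y : X) :=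
        ENNReal.tsum_le_tsum hbound
    _ = ∑' z : X, Y.indicator (S.indicator fun _ => ν {u : U | (u : R) ∈ P * P⁻¹}) z :=
        tsum_subtype Y _
    _ = ∑' z : X, S.indicator (fun _ => ν {u : U | (u : R) ∈ P * P⁻¹}) z := by
        refine tsum_congr fun z => ?_
        rw [Set.indicator_indicator]
        have hSY : S ⊆ Y := by
          rintro _ ⟨γ, -, rfl⟩
          exact ⟨γ, rfl⟩
        rw [Set.inter_eq_right.2 hSY]
    _ = ∑' z : S, ν {u : U | (u : R) ∈ P * P⁻¹} := (tsum_subtype S _).symm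
    _ = ν {u : U | (u : R) ∈ P * P⁻¹} * (S.encard : ℝ≥0∞) := by
        rw [ENNReal.tsum_set_const, mul_comm]

/-- **The orbit-count unfolding inequality (finite covolume by descent).** Let `R` be a locally
compact second countable Hausdorff group with left Haar measure `μ`, `U ≤ R` a closed subgroup with
a left-invariant measure `ν` finite on compacts, `Γ ≤ R` a subgroup with a fundamental domain `F_R`
(left action), `Λ ≤ U` the subgroup `Γ ∩ U` (countable) with a measurable fundamental domain
`F_U ⊆ U`, `P ⊆ R` compact, and `τ : Γ → X` with fibres the cosets `Λ γ`. Then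
`ν(F_U) · μ(P) ≤ ν(U ∩ P P⁻¹) · ∫_{F_R} #(τ {γ : γ g ∈ U P}) dμ(g)`.
Proof: `ν(F_U) μ(P) = ∫_R Ψ dμ` with `Ψ(x) = ν(F_U ∩ {u : u⁻¹ x ∈ P})` (Tonelli,
`lintegral_measure_inter_slice`); fold over `Γ` (`∫_R Ψ = ∫_{F_R} Σ_γ Ψ(γ g)`,
Mathlib `IsFundamentalDomain.lintegral_eq_tsum'`); regroup (`tsum_measure_inter_slice_le`).
So the COVOLUME `ν(F_U)` of `Λ` in `U` is finite as soon as the orbit count is integrable over a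
fundamental domain of `Γ` — Borel–Harish-Chandra's reduction of the finiteness of `U ∩ Γ \ U` to
reduction theory of `R` (Ann. of Math. 75 (1962), §7, Thm. 7.8 with §9; adelic form Borel (1963) §5).
[cite: BorelHarishChandra1962, §7 Thm. 7.8] [cite: Borel1963, §5] -/
theorem covolume_mul_measure_le_lintegral_encard [T2Space R]
    (hU : IsClosed (U : Set R)) (μ : Measure R) [μ.IsMulLeftInvariant] [SFinite μ]
    (ν : Measure U) [ν.IsMulLeftInvariant] [SFinite ν] [IsFiniteMeasureOnCompacts ν]
    (Γ : Subgroup R) [Countable Γ] {F_R : Set R} (hFR : IsFundamentalDomain Γ F_R μ)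
    (Λ : Subgroup U) [Countable Λ] (hΛ : ∀ u : U, u ∈ Λ ↔ (u : R) ∈ Γ)
    {F_U : Set U} (hFU : IsFundamentalDomain Λ F_U ν) (hFUm : MeasurableSet F_U)
    {P : Set R} (hP : IsCompact P)
    {X : Type*} (τ : Γ → X) (hτ : ∀ γ γ' : Γ, τ γ = τ γ' ↔ (γ' : R) * ((γ : R))⁻¹ ∈ U) :
    ν F_U * μ P ≤ ν {u : U | (u : R) ∈ P * P⁻¹} *
      ∫⁻ g in F_R, ((τ '' {γ : Γ | (γ : R) * g ∈ (U : Set R) * P}).encard : ℝ≥0∞) ∂μ := by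
  have hPm : MeasurableSet P := hP.measurableSet
  set M : ℝ≥0∞ := ν {u : U | (u : R) ∈ P * P⁻¹} with hM
  have hMtop : M ≠ ∞ := (measure_coe_mem_mul_inv_lt_top U hU ν hP).ne
  set Ψ : R → ℝ≥0∞ := fun x => ν (F_U ∩ {u : U | ((u : R))⁻¹ * x ∈ P}) with hΨ
  have hΨm : Measurable Ψ := measurable_measure_inter_slice U ν hFUm hPm
  -- Tonelli and folding over `Γ`
  rw [← lintegral_measure_inter_slice U μ ν hFUm hPm, hFR.lintegral_eq_tsum' _]
  have hswap : ∑' γ : Γ, ∫⁻ x in F_R, Ψ (γ⁻¹ • x) ∂μ = ∫⁻ x in F_R, ∑' γ : Γ, Ψ (γ⁻¹ • x) ∂μ := by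
    rw [lintegral_tsum]
    intro γ
    exact (hΨm.comp (measurable_const_mul ((γ⁻¹ : Γ) : R))).aemeasurable
  rw [hswap]
  -- pointwise regrouping
  have hpt : ∀ x : R, ∑' γ : Γ, Ψ (γ⁻¹ • x) ≤
      M * ((τ '' {γ : Γ | (γ : R) * x ∈ (U : Set R) * P}).encard : ℝ≥0∞) := by
    intro x
    calc ∑' γ : Γ, Ψ (γ⁻¹ • x) = ∑' γ : Γ, Ψ (γ • x) := (Equiv.inv Γ).tsum_eq (fun γ => Ψ (γ • x))
      _ = ∑' γ : Γ, ν (F_U ∩ {u : U | ((u : R))⁻¹ * ((γ : R) * x) ∈ P}) := by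
          simp only [hΨ, Subgroup.smul_def, smul_eq_mul]
      _ ≤ M * _ := tsum_measure_inter_slice_le U ν Γ Λ hΛ hFU P τ hτ x
  calc ∫⁻ x in F_R, ∑' γ : Γ, Ψ (γ⁻¹ • x) ∂μ
      ≤ ∫⁻ x in F_R, M * ((τ '' {γ : Γ | (γ : R) * x ∈ (U : Set R) * P}).encard : ℝ≥0∞) ∂μ :=
        lintegral_mono fun x => hpt x
    _ = M * ∫⁻ x in F_R, ((τ '' {γ : Γ | (γ : R) * x ∈ (U : Set R) * P}).encard : ℝ≥0∞) ∂μ :=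
        lintegral_const_mul' M _ hMtop

/-- **Finite covolume from an integrable orbit count** (the form consumed downstream): under the
hypotheses of `covolume_mul_measure_le_lintegral_encard`, if `μ(P) ≠ 0` and the orbit-count
integral over `F_R` is finite then `ν(F_U) < ∞`. [cite: BorelHarishChandra1962, §7 Thm. 7.8]
[cite: Borel1963, §5] -/
theorem measure_fundamentalDomain_lt_top_of_lintegral_encard_lt_top [T2Space R]
    (hU : IsClosed (U : Set R)) (μ : Measure R) [μ.IsMulLeftInvariant] [SFinite μ]
    (ν : Measure U) [ν.IsMulLeftInvariant] [SFinite ν] [IsFiniteMeasureOnCompacts ν]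
    (Γ : Subgroup R) [Countable Γ] {F_R : Set R} (hFR : IsFundamentalDomain Γ F_R μ)
    (Λ : Subgroup U) [Countable Λ] (hΛ : ∀ u : U, u ∈ Λ ↔ (u : R) ∈ Γ)
    {F_U : Set U} (hFU : IsFundamentalDomain Λ F_U ν) (hFUm : MeasurableSet F_U)
    {P : Set R} (hP : IsCompact P) (hP0 : μ P ≠ 0)
    {X : Type*} (τ : Γ → X) (hτ : ∀ γ γ' : Γ, τ γ = τ γ' ↔ (γ' : R) * ((γ : R))⁻¹ ∈ U)
    (hint : ∫⁻ g in F_R, ((τ '' {γ : Γ | (γ : R) * g ∈ (U : Set R) * P}).encard : ℝ≥0∞) ∂μ < ∞) :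
    ν F_U < ∞ := by
  have h := covolume_mul_measure_le_lintegral_encard U hU μ ν Γ hFR Λ hΛ hFU hFUm hP τ hτ
  have hfin : ν {u : U | (u : R) ∈ P * P⁻¹} *
      ∫⁻ g in F_R, ((τ '' {γ : Γ | (γ : R) * g ∈ (U : Set R) * P}).encard : ℝ≥0∞) ∂μ < ∞ :=
    ENNReal.mul_lt_top (measure_coe_mem_mul_inv_lt_top U hU ν hP) hint
  by_contra htop
  rw [not_lt, top_le_iff] at htop
  rw [htop, ENNReal.top_mul hP0] at h
  exact (lt_irrefl _) ((top_le_iff.1 h) ▸ hfin)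

end Unfolding

section Domination

variable {R : Type*} [Group R] [MeasurableSpace R] [MeasurableMul R]

/-- **Domination of a quotient integral by a covering set.** Let `Γ ≤ R` be a countable subgroup,
`μ` a left-`Γ`-invariant measure with fundamental domain `F` (left action), `f ≥ 0` a
left-`Γ`-invariant function, and `A ⊆ ⋃_γ γ · S`. Then `∫_{F ∩ A} f ≤ ∫_S f`: indeed
`∫_S f = Σ_γ ∫_{γ S ∩ F} f(γ⁻¹ ·) = Σ_γ ∫_{γ S ∩ F} f ≥ ∫_{⋃_γ γ S ∩ F} f ≥ ∫_{F ∩ A} f`. This is how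
a Siegel set `S` with `Γ · S ⊇ A` controls integrals over `Γ \ A` (Borel (1963), §5; Godement,
Sém. Bourbaki 257, §8). [cite: Borel1963, §5] [cite: Godement1964, §8] -/
theorem setLIntegral_inter_le_of_subset_iUnion_smul (Γ : Subgroup R) [Countable Γ]
    (μ : Measure R) [SMulInvariantMeasure Γ R μ] {F : Set R} (hF : IsFundamentalDomain Γ F μ)
    {f : R → ℝ≥0∞} (hf : ∀ (γ : Γ) (x : R), f ((γ : R) * x) = f x)
    {A S : Set R} (hAS : A ⊆ ⋃ γ : Γ, γ • S) :
    ∫⁻ x in F ∩ A, f x ∂μ ≤ ∫⁻ x in S, f x ∂μ := by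
  have hsub : F ∩ A ⊆ ⋃ γ : Γ, (γ • S ∩ F) := by
    rintro x ⟨hxF, hxA⟩
    obtain ⟨γ, hγ⟩ := Set.mem_iUnion.1 (hAS hxA)
    exact Set.mem_iUnion.2 ⟨γ, hγ, hxF⟩
  calc ∫⁻ x in F ∩ A, f x ∂μ ≤ ∫⁻ x in ⋃ γ : Γ, (γ • S ∩ F), f x ∂μ := lintegral_mono_set hsub
    _ ≤ ∑' γ : Γ, ∫⁻ x in γ • S ∩ F, f x ∂μ := lintegral_iUnion_le _ _
    _ = ∑' γ : Γ, ∫⁻ x in γ • S ∩ F, f (γ⁻¹ • x) ∂μ := by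
        refine tsum_congr fun γ => lintegral_congr fun x => ?_
        rw [Subgroup.smul_def, smul_eq_mul, Subgroup.coe_inv]
        conv_lhs => rw [← hf γ⁻¹ x, Subgroup.coe_inv]
    _ = ∫⁻ x in S, f x ∂μ := (hF.setLIntegral_eq_tsum' f S).symm

end Domination



end Literature.MeasureTheory.Group

end
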